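import Literature.NumberTheory.Sieve.HeathBrownCubicTypeII
import Literature.NumberTheory.Sieve.HeathBrownCubicSieveDecompositionProofs
import Mathlib.Analysis.SpecialFunctions.Pow.Asymptotics
import Mathlib.Analysis.SpecialFunctions.Log.Base
import HarnessLib

/-!
# The Type II block (3.15) from Heath-Brown's Lemmas 3.7, 3.8, 3.9 and 3.10

Pure-proof companion of `HeathBrownCubicTypeII` (eighth layer of the decomposition of **parity.S18**
along Heath-Brown, Acta Math. 186 (2001)). The previous layer models the bilinear sums of pp. 14–20
and vendors Lemmas 3.7–3.10 as named facts; here the argument of pp. 19–21 that combines them into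
the bound `≪ τη²X²/log X` for the Type II terms of Lemma 3.4 is carried out, **proving
`HeathBrown2001_typeII_terms`** (`HeathBrown2001_typeII_terms_of`):

1. (`piece_bound`) for one admissible vector `𝐦` and one coefficient `c_R`,
   `Û(𝒜) − κÛ(ℬ) = [Û_e(𝒜) − κÛ(ℬ)] + Û_f(𝒜)` ((3.11), `Û = Û_e + Û_f`, p. 19), and `Û_f(𝒜)` is the
   sum of its dyadic pieces `V < N(S) ≤ 2V` (`bilin_dyadic`; the support of `f_S(𝐦)` lies in
   `X^{1+τ} ≤ N(S) < X^{3/2−τ}` by (3.8), covered by `J + 1 ≤ log X` levels `V_j = 2^{j−1}X^{1+τ}`,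
   `dyadic_levels`, `dyadicTop_add_one_le`) — so Lemma 3.9 and Lemma 3.10 bound it by
   `B₉ + (J+1)B₁₀`;
2. (`indexCount_le_log`) "since `n ≪ τ^{-1}` and `m_i ≪ ξ^{-1}`, the number of possibilities for
   `n, 𝐦` is `≪ τ^{-1}(cξ^{-1})^{cτ^{-1}} ≪ log X`" (p. 20): all four families of pieces have at most
   `N₂ = (⌊3/(2τ)⌋ + 1)B^{⌊3/(2τ)⌋+3} ≤ log X` members (`B = ⌊(3/2−τ)ξ^{-1}⌋ + 1`) once
   `log log X ≥ 4096`;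
3. (`HeathBrown2001_typeII_terms_of`) with `ϖ = 1/6`, `η = (log X)^{−c}`, `c = 2c_* + 6`,
   `Q₁ = (log X)^A`, `A = 160(2c + c_* + 4)` (`c_* = max(c₉, c₁₀, 0)` the exponents of Lemmas 3.9 and
   3.10), Lemma 3.8 supplies (3.14) up to `Q₁`, Lemma 3.7 bounds the ten approximation errors by
   `ξτ^{−4}·η²X²/log X = τη²X²/log X` resp. `κ·ξτ^{−4}ηX³/log X = (σ₀/3)τη²X²/log X`, and the Type II
   contributions `(log X)B₉ ≤ |C₉|τη²X²/log X`, `(log X)²B₁₀ ≤ |C₁₀|τη²X²/log X` because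
   `(log X)^{-1} ≤ τ`; total constant `5|C₇|(1 + σ₀/3) + 5(|C₉| + |C₁₀|)` ((3.15) and p. 21).

Consequently (`Literature.NumberTheory.Sieve.setOf_prime_cube_add_two_mul_cube_infinite_of_lemmas`) parity.S18 rests on
exactly seven named facts, each a printed lemma: Landau's prime ideal theorem
(`Literature.NumberTheory.LFunctions.NumberField.primeIdealTheorem`) and Heath-Brown's Lemmas 3.5, 3.6, 3.7, 3.8, 3.9, 3.10;
everything else along the chain is proved (see `HeathBrownCubicSieveDecompositionProofs` for the list
up to Lemma 3.4, plus the present two files).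

## References

* D. R. Heath-Brown, *Primes represented by `x³ + 2y³`*, Acta Math. 186 (2001), 1–84: pp. 19–21
  ((3.11), Lemmas 3.9–3.10, "`O(log X)` sums", "number of possibilities for `n, 𝐦`", (3.15), the
  choices of `η`, `Q₁`, `ϖ`). [cite: HeathBrownActa2001, §3 (3.15) and pp. 19–21]
* G. Harman, *Prime-Detecting Sieves* (2007), §13.2, (13.2.17) and the closing paragraph of §13.2.
  [cite: Harman2007, §13.2 (13.2.17)]

## Mathlib / tree search

Mathlib asymptotics used: `isLittleO_log_rpow_atTop`, `Real.tendsto_log_atTop`,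
`Filter.eventually_atTop`, `Nat.ceil_lt_add_one`, `Real.log_two_gt_d9`, `Real.log_two_lt_d9`,
`Real.log_le_sub_one_of_pos`, `Finset.abs_sum_le_sum_abs`, `Fintype.card_piFinset`. Tree:
`HeathBrownCubicTypeII` (all objects and the four facts), `HeathBrownCubicSieveDecompositionProofs`
(`eventually_params`, `HeathBrown2001_sieveComparison_of`,
`setOf_prime_cube_add_two_mul_cube_infinite_of_sieveLemmas`), `HeathBrownCubicSieveDecomposition`
(`HeathBrown2001_typeII_terms`, `HeathBrown2001_lemma_3_5`, `HeathBrown2001_lemma_3_6`).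
-/

noncomputable section

open Polynomial NumberField Finset Filter Topology Asymptotics

namespace Literature.NumberTheory.Sieve.CubicSieve

open LFunctions.CubeRootTwoField CubicPrimes

/-! ### Two API remarks on the previous layer (review follow-ups) -/

/-- Membership in `nPairs`: the cut-off `mBound τ` in its definition is redundant (for `τ > 0`,
`n₂ < n₁ ≤ (1 − τ)ξ^{-1} − 1 < mBound τ`), so `nPairs τ` is exactly the set of pairs of p. 16.
[cite: HeathBrownActa2001, §3 p. 16] -/
theorem mem_nPairs_iff {τ : ℝ} (hτ : 0 < τ) {nn : ℕ × ℕ} :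
    nn ∈ nPairs τ ↔
      τ / hbXi τ ≤ (nn.2 : ℝ) ∧ nn.2 < nn.1 ∧ (nn.1 : ℝ) ≤ (1 - τ) / hbXi τ - 1 ∧
        (3 / 2 + τ) / hbXi τ ≤ (nn.1 : ℝ) + nn.2 := by
  classical
  unfold nPairs
  simp only [mem_filter, mem_product, mem_range, and_iff_right_iff_imp]
  rintro ⟨-, h12, h1, -⟩
  have hξ := hbXi_pos hτ
  -- `n₁ + 1 ≤ (1 − τ)/ξ ≤ (3/2 − τ)/ξ`, so `n₁ < mBound τ`, and `n₂ < n₁`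
  have hle : (1 - τ) / hbXi τ ≤ (3 / 2 - τ) / hbXi τ :=
    div_le_div_of_nonneg_right (by linarith) hξ.le
  have h1' : ((nn.1 + 1 : ℕ) : ℝ) ≤ (3 / 2 - τ) / hbXi τ := by push_cast; linarith
  have hn1 : nn.1 + 1 ≤ ⌊(3 / 2 - τ) / hbXi τ⌋₊ := Nat.le_floor h1'
  have hB : nn.1 < mBound τ := by rw [mBound]; omega
  exact ⟨hB, lt_trans h12 hB⟩

/-- The divisor-counting function `τ(R)` of the Type I bounds (`idealDivisorCount`,
`HeathBrownCubicSieveSetup`) is the cardinality of `idealDivisors R`. [folklore] -/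
theorem idealDivisorCount_eq_card (R : Ideal (𝓞 K)) : idealDivisorCount R = #(idealDivisors R) :=
  rfl

/-! ### Dyadic decomposition of a weight by the norm of `S` (p. 20) -/

/-- A weight supported on `V₀ < N(S) ≤ 2^{J+1}V₀` is the sum of its restrictions to the dyadic
ranges `2^jV₀ < N(S) ≤ 2^{j+1}V₀`, `0 ≤ j ≤ J` ("each term `U_f(𝒜)` may be written as a sum of
`O(log X)` sums of the form considered in Lemma 3.10", p. 20). [cite: HeathBrownActa2001, §3 p. 20] -/
theorem dyadic_pointwise {V₀ : ℝ} (hV₀ : 0 < V₀) (J : ℕ) (d : Ideal (𝓞 K) → ℝ)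
    (hd : ∀ S, d S ≠ 0 → V₀ < (Ideal.absNorm S : ℝ) ∧ (Ideal.absNorm S : ℝ) ≤ 2 ^ (J + 1) * V₀)
    (S : Ideal (𝓞 K)) :
    d S = ∑ j ∈ range (J + 1),
      (if 2 ^ j * V₀ < (Ideal.absNorm S : ℝ) ∧ (Ideal.absNorm S : ℝ) ≤ 2 * (2 ^ j * V₀) then d S
        else 0) := by
  by_cases h0 : d S = 0
  · simp [h0]
  obtain ⟨hlo, hhi⟩ := hd S h0
  set N : ℝ := (Ideal.absNorm S : ℝ) with hN
  -- the set of levels below `N`, and its maximum `j₀`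
  set T : Finset ℕ := (range (J + 1)).filter fun j => 2 ^ j * V₀ < N with hT
  have h0T : 0 ∈ T := by
    rw [hT, mem_filter, mem_range]; exact ⟨Nat.succ_pos J, by simpa using hlo⟩
  have hTne : T.Nonempty := ⟨0, h0T⟩
  set j₀ := T.max' hTne with hj₀
  have hj₀T : j₀ ∈ T := max'_mem T hTne
  rw [hT, mem_filter, mem_range] at hj₀T
  obtain ⟨hj₀J, hj₀lo⟩ := hj₀T
  have hj₀hi : N ≤ 2 * (2 ^ j₀ * V₀) := by
    by_cases hJ : j₀ + 1 < J + 1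
    · by_contra hcon
      rw [not_le] at hcon
      have hmem : j₀ + 1 ∈ T := by
        rw [hT, mem_filter, mem_range]
        exact ⟨hJ, by rw [pow_succ]; linarith⟩
      have := le_max' T (j₀ + 1) hmem
      rw [← hj₀] at this
      omega
    · have hj₀eq : j₀ = J := by omega
      rw [hj₀eq]
      calc N ≤ 2 ^ (J + 1) * V₀ := hhi
        _ = 2 * (2 ^ J * V₀) := by rw [pow_succ]; ring
  -- uniqueness of the level
  have huniq : ∀ j, 2 ^ j * V₀ < N ∧ N ≤ 2 * (2 ^ j * V₀) → j = j₀ := by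
    rintro j ⟨hjlo, hjhi⟩
    by_contra hne
    rcases Nat.lt_or_gt_of_ne hne with hlt | hlt
    · -- j < j₀: N ≤ 2^{j+1} V₀ ≤ 2^{j₀} V₀ < N
      have h1 : (2 : ℝ) ^ (j + 1) ≤ 2 ^ j₀ := pow_le_pow_right₀ (by norm_num) hlt
      have h2 : 2 * (2 ^ j * V₀) = 2 ^ (j + 1) * V₀ := by rw [pow_succ]; ring
      nlinarith
    · have h1 : (2 : ℝ) ^ (j₀ + 1) ≤ 2 ^ j := pow_le_pow_right₀ (by norm_num) hlt
      have h2 : 2 * (2 ^ j₀ * V₀) = 2 ^ (j₀ + 1) * V₀ := by rw [pow_succ]; ring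
      nlinarith
  have hfilter : (range (J + 1)).filter
      (fun j => 2 ^ j * V₀ < N ∧ N ≤ 2 * (2 ^ j * V₀)) = {j₀} := by
    ext j
    simp only [mem_filter, mem_range, mem_singleton]
    constructor
    · rintro ⟨-, hj⟩; exact huniq j hj
    · rintro rfl; exact ⟨hj₀J, hj₀lo, hj₀hi⟩
  rw [← sum_filter, hfilter, sum_singleton]

/-- The bilinear sum is additive over finite sums of weights. [folklore] -/
theorem bilin_finset_sum {ι α : Type*} (E : Finset ι) (I : ι → Ideal (𝓞 K))
    (c : Ideal (𝓞 K) → ℝ) (s : Finset α) (g : α → Ideal (𝓞 K) → ℝ) :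
    bilin E I c (fun S => ∑ a ∈ s, g a S) = ∑ a ∈ s, bilin E I c (g a) := by
  simp only [bilin, mul_sum]
  rw [sum_comm]
  refine sum_congr rfl fun i _ => ?_
  rw [sum_comm]

/-- **Dyadic decomposition of a bilinear sum** whose weight is supported on
`V₀ < N(S) ≤ 2^{J+1}V₀`: it is the sum over `0 ≤ j ≤ J` of the sums restricted to
`2^jV₀ < N(S) ≤ 2·2^jV₀`, the shape of Lemma 3.10. [cite: HeathBrownActa2001, §3 p. 20] -/
theorem bilin_dyadic {ι : Type*} (E : Finset ι) (I : ι → Ideal (𝓞 K)) (c : Ideal (𝓞 K) → ℝ)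
    {V₀ : ℝ} (hV₀ : 0 < V₀) (J : ℕ) (d : Ideal (𝓞 K) → ℝ)
    (hd : ∀ S, d S ≠ 0 → V₀ < (Ideal.absNorm S : ℝ) ∧ (Ideal.absNorm S : ℝ) ≤ 2 ^ (J + 1) * V₀) :
    bilin E I c d = ∑ j ∈ range (J + 1), bilin E I c
      (fun S => if 2 ^ j * V₀ < (Ideal.absNorm S : ℝ) ∧ (Ideal.absNorm S : ℝ) ≤ 2 * (2 ^ j * V₀)
        then d S else 0) := by
  rw [← bilin_finset_sum]
  congr 1
  funext S
  exact dyadic_pointwise hV₀ J d hd S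

/-! ### The dyadic levels `V_j = 2^{j−1}X^{1+τ}`, `0 ≤ j ≤ J` -/

/-- The dyadic levels `V_j = 2^j · X^{1+τ}/2`, `0 ≤ j ≤ J`, lie in `[X^{1+τ}/2, X^{3/2−τ}]` (the range
`X^{1+τ} ≪ V ≪ X^{3/2−τ}` of Lemma 3.10 with constants `1/2` and `1`), and `2^{J+1} · X^{1+τ}/2 ≥ X^{3/2−τ}`
(`X > 1`, `0 < τ ≤ 1/4`). [folklore] -/
theorem dyadic_levels {X τ : ℝ} (hX : 1 < X) (hτ4 : τ ≤ 1 / 4) :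
    (∀ j ≤ dyadicTop X τ,
        1 / 2 * X ^ (1 + τ) ≤ 2 ^ j * (X ^ (1 + τ) / 2) ∧
          2 ^ j * (X ^ (1 + τ) / 2) ≤ 1 * X ^ (3 / 2 - τ)) ∧
      X ^ (3 / 2 - τ) ≤ 2 ^ (dyadicTop X τ + 1) * (X ^ (1 + τ) / 2) := by
  have hX0 : 0 < X := by linarith
  have hL : 0 < Real.log X := Real.log_pos hX
  have hl2 : 0 < Real.log 2 := Real.log_pos one_lt_two
  have hA : 0 ≤ (1 / 2 - 2 * τ) * Real.log X / Real.log 2 :=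
    div_nonneg (mul_nonneg (by linarith) hL.le) hl2.le
  have hP : 0 < X ^ (1 + τ) := Real.rpow_pos_of_pos hX0 _
  set J := dyadicTop X τ with hJ
  -- `2^J` versus `X^{1/2 − 2τ}`
  have hsplit : X ^ (3 / 2 - τ) = X ^ (1 / 2 - 2 * τ) * X ^ (1 + τ) := by
    rw [← Real.rpow_add hX0]; ring_nf
  have h2J_ge : X ^ (1 / 2 - 2 * τ) ≤ (2 : ℝ) ^ J := by
    have h1 : (1 / 2 - 2 * τ) * Real.log X / Real.log 2 ≤ J := Nat.le_ceil _
    rw [div_le_iff₀ hl2] at h1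
    calc X ^ (1 / 2 - 2 * τ) = Real.exp ((1 / 2 - 2 * τ) * Real.log X) := by
          rw [Real.rpow_def_of_pos hX0]; ring_nf
      _ ≤ Real.exp (J * Real.log 2) := Real.exp_le_exp.mpr h1
      _ = (2 : ℝ) ^ J := by rw [← Real.rpow_natCast, Real.rpow_def_of_pos two_pos]; ring_nf
  have h2J_le : (2 : ℝ) ^ J ≤ 2 * X ^ (1 / 2 - 2 * τ) := by
    have h1 : (J : ℝ) < (1 / 2 - 2 * τ) * Real.log X / Real.log 2 + 1 := Nat.ceil_lt_add_one hA
    have h2 : (J : ℝ) * Real.log 2 ≤ (1 / 2 - 2 * τ) * Real.log X + Real.log 2 := by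
      have := mul_lt_mul_of_pos_right h1 hl2
      rw [add_mul, one_mul, div_mul_cancel₀ _ hl2.ne'] at this
      exact this.le
    calc (2 : ℝ) ^ J = Real.exp (J * Real.log 2) := by
          rw [← Real.rpow_natCast, Real.rpow_def_of_pos two_pos]; ring_nf
      _ ≤ Real.exp ((1 / 2 - 2 * τ) * Real.log X + Real.log 2) := Real.exp_le_exp.mpr h2
      _ = 2 * X ^ (1 / 2 - 2 * τ) := by
          rw [Real.exp_add, Real.exp_log two_pos, Real.rpow_def_of_pos hX0]; ring_nf
  refine ⟨fun j hj => ⟨?_, ?_⟩, ?_⟩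
  · have : (1 : ℝ) ≤ 2 ^ j := one_le_pow₀ (by norm_num)
    nlinarith
  · have hj' : (2 : ℝ) ^ j ≤ 2 ^ J := pow_le_pow_right₀ (by norm_num) hj
    calc 2 ^ j * (X ^ (1 + τ) / 2) ≤ 2 ^ J * (X ^ (1 + τ) / 2) := by gcongr
      _ ≤ (2 * X ^ (1 / 2 - 2 * τ)) * (X ^ (1 + τ) / 2) := by gcongr
      _ = 1 * X ^ (3 / 2 - τ) := by rw [hsplit]; ring
  · calc X ^ (3 / 2 - τ) = X ^ (1 / 2 - 2 * τ) * X ^ (1 + τ) := hsplit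
      _ ≤ 2 ^ J * X ^ (1 + τ) := by gcongr
      _ = 2 ^ (J + 1) * (X ^ (1 + τ) / 2) := by rw [pow_succ]; ring

/-- The number of dyadic levels is `≤ log X` once `log X ≥ 8` (and `0 ≤ τ ≤ 1/4`):
`J + 1 ≤ (1/2) log X / log 2 + 2 ≤ log X`. [folklore] -/
theorem dyadicTop_add_one_le {X τ : ℝ} (hL : 8 ≤ Real.log X) (hτ0 : 0 ≤ τ) (hτ4 : τ ≤ 1 / 4) :
    ((dyadicTop X τ : ℕ) : ℝ) + 1 ≤ Real.log X := by
  have hl2 : (0.6931471803 : ℝ) < Real.log 2 := Real.log_two_gt_d9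
  have hl2pos : 0 < Real.log 2 := by linarith
  have hA : 0 ≤ (1 / 2 - 2 * τ) * Real.log X / Real.log 2 :=
    div_nonneg (mul_nonneg (by linarith) (by linarith)) hl2pos.le
  have h1 : ((dyadicTop X τ : ℕ) : ℝ) < (1 / 2 - 2 * τ) * Real.log X / Real.log 2 + 1 :=
    Nat.ceil_lt_add_one hA
  have h2 : (1 / 2 - 2 * τ) * Real.log X / Real.log 2 ≤ (1 / 2) * Real.log X / Real.log 2 := by
    gcongr; linarith
  have h3 : (1 / 2) * Real.log X / Real.log 2 ≤ (3 / 4) * Real.log X := by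
    rw [div_le_iff₀ hl2pos]; nlinarith
  linarith

/-! ### Counting the vectors `(n, 𝐦)` (p. 20) -/

/-- `#mIndexU τ n ≤ B^{n+1}`, `B = mBound τ`. [folklore] -/
theorem card_mIndexU_le (τ : ℝ) (n : ℕ) : #(mIndexU τ n) ≤ mBound τ ^ (n + 1) := by
  classical
  unfold mIndexU
  refine (card_filter_le _ _).trans ?_
  rw [Fintype.card_piFinset]; simp

/-- `#mIndexCore τ k ≤ B^k`. [folklore] -/
theorem card_mIndexCore_le (τ : ℝ) (k : ℕ) : #(mIndexCore τ k) ≤ mBound τ ^ k := by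
  classical
  unfold mIndexCore
  refine (card_filter_le _ _).trans ?_
  rw [Fintype.card_piFinset]; simp

/-- `#mIndexU2 τ n n₂ ≤ B^{n+1}`. [folklore] -/
theorem card_mIndexU2_le (τ : ℝ) (n n₂ : ℕ) : #(mIndexU2 τ n n₂) ≤ mBound τ ^ (n + 1) := by
  classical
  unfold mIndexU2
  refine (card_filter_le _ _).trans ?_
  rw [Fintype.card_piFinset]; simp

/-- `#nPairs τ ≤ B²`. [folklore] -/
theorem card_nPairs_le (τ : ℝ) : #(nPairs τ) ≤ mBound τ ^ 2 := by
  classical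
  unfold nPairs
  refine (card_filter_le _ _).trans ?_
  rw [card_product, card_range, sq]

/-- `1 ≤ B`. [folklore] -/
theorem one_le_mBound (τ : ℝ) : 1 ≤ mBound τ := Nat.le_add_left 1 _

/-- `n₀ = ⌊1/τ⌋ + 1 ≤ ⌊3/(2τ)⌋ + 1` for `τ > 0`. [folklore] -/
theorem chainBound_le {τ : ℝ} (hτ : 0 < τ) : chainBound τ ≤ u2Bound τ + 1 := by
  rw [chainBound, u2Bound]
  refine Nat.add_le_add_right (Nat.floor_mono ?_) 1
  rw [div_le_div_iff₀ hτ (by positivity)]; linarith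

/-- `∑_{3 ≤ n ≤ n₀} #mIndexU τ n ≤ N₂`. [folklore] -/
theorem sum_card_mIndexU_le {τ : ℝ} (hτ : 0 < τ) :
    ∑ n ∈ Icc 3 (chainBound τ), (#(mIndexU τ n) : ℝ) ≤ indexCount τ := by
  have hB := one_le_mBound τ
  have hcb := chainBound_le hτ
  calc ∑ n ∈ Icc 3 (chainBound τ), (#(mIndexU τ n) : ℝ)
      ≤ ∑ _n ∈ Icc 3 (chainBound τ), ((mBound τ ^ (u2Bound τ + 3) : ℕ) : ℝ) := by
        refine sum_le_sum fun n hn => ?_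
        rw [mem_Icc] at hn
        exact_mod_cast (card_mIndexU_le τ n).trans (Nat.pow_le_pow_right hB (by omega))
    _ = (#(Icc 3 (chainBound τ)) : ℝ) * ((mBound τ ^ (u2Bound τ + 3) : ℕ) : ℝ) := by
        rw [sum_const, nsmul_eq_mul]
    _ ≤ ((u2Bound τ + 1 : ℕ) : ℝ) * ((mBound τ ^ (u2Bound τ + 3) : ℕ) : ℝ) := by
        gcongr
        rw [Nat.card_Icc]; omega
    _ = indexCount τ := by rw [indexCount]; push_cast; ring

/-- `#mIndexU τ n ≤ N₂` for `n ≤ 2`. [folklore] -/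
theorem card_mIndexU_le_indexCount (τ : ℝ) {n : ℕ} (hn : n ≤ 2) :
    (#(mIndexU τ n) : ℝ) ≤ indexCount τ := by
  have hB := one_le_mBound τ
  have h1 : #(mIndexU τ n) ≤ mBound τ ^ (u2Bound τ + 3) :=
    (card_mIndexU_le τ n).trans (Nat.pow_le_pow_right hB (by omega))
  have h2 : mBound τ ^ (u2Bound τ + 3) ≤ indexCount τ := by
    rw [indexCount]; exact Nat.le_mul_of_pos_left _ (Nat.succ_pos _)
  exact_mod_cast h1.trans h2

/-- `#mIndexCore τ 1 ≤ N₂`. [folklore] -/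
theorem card_mIndexCore_one_le_indexCount (τ : ℝ) : (#(mIndexCore τ 1) : ℝ) ≤ indexCount τ := by
  have hB := one_le_mBound τ
  have h1 : #(mIndexCore τ 1) ≤ mBound τ ^ (u2Bound τ + 3) :=
    (card_mIndexCore_le τ 1).trans (Nat.pow_le_pow_right hB (by omega))
  have h2 : mBound τ ^ (u2Bound τ + 3) ≤ indexCount τ := by
    rw [indexCount]; exact Nat.le_mul_of_pos_left _ (Nat.succ_pos _)
  exact_mod_cast h1.trans h2

/-- `∑_{(n₁,n₂)} ∑_{n ≤ ⌊3/(2τ)⌋} #mIndexU2 τ n n₂ ≤ N₂`. [folklore] -/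
theorem sum_card_mIndexU2_le (τ : ℝ) :
    ∑ nn ∈ nPairs τ, ∑ n ∈ range (u2Bound τ + 1), (#(mIndexU2 τ n nn.2) : ℝ) ≤ indexCount τ := by
  have hB := one_le_mBound τ
  calc ∑ nn ∈ nPairs τ, ∑ n ∈ range (u2Bound τ + 1), (#(mIndexU2 τ n nn.2) : ℝ)
      ≤ ∑ _nn ∈ nPairs τ, ∑ _n ∈ range (u2Bound τ + 1), ((mBound τ ^ (u2Bound τ + 1) : ℕ) : ℝ) := by
        refine sum_le_sum fun nn _ => sum_le_sum fun n hn => ?_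
        rw [mem_range] at hn
        exact_mod_cast (card_mIndexU2_le τ n nn.2).trans (Nat.pow_le_pow_right hB (by omega))
    _ = (#(nPairs τ) : ℝ) * ((u2Bound τ + 1 : ℕ) * ((mBound τ ^ (u2Bound τ + 1) : ℕ) : ℝ)) := by
        rw [sum_const, sum_const, card_range, nsmul_eq_mul, nsmul_eq_mul]
    _ ≤ ((mBound τ ^ 2 : ℕ) : ℝ) * ((u2Bound τ + 1 : ℕ) * ((mBound τ ^ (u2Bound τ + 1) : ℕ) : ℝ)) := by
        gcongr; exact_mod_cast card_nPairs_le τ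
    _ = indexCount τ := by rw [indexCount]; push_cast; ring

/-- **"The number of possibilities for `n, 𝐦` is `≪ τ^{-1}(cξ^{-1})^{cτ^{-1}} ≪ log X`"** (p. 20, by
(2.5), (3.4), (3.10)): with `τ = (log log X)^{−1/6}`, `ξ = τ⁵`, `u = τ^{-1}`, one has
`N₂ ≤ 2u · (2u⁵)^{3u} = exp(log 2u + 3u log 2u⁵) ≤ exp(u⁶) = log X` once `log log X ≥ 4096`.
[cite: HeathBrownActa2001, §3 p. 20] -/
theorem indexCount_le_log {X : ℝ} (hL : 0 < Real.log X) (hM : 4096 ≤ Real.log (Real.log X)) :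
    (indexCount (hbTau (1 / 6) X) : ℝ) ≤ Real.log X := by
  set L := Real.log X with hLdef
  set M := Real.log L with hMdef
  have hMpos : 0 < M := by linarith
  set u := M ^ (1 / 6 : ℝ) with hu
  have hu4 : (4 : ℝ) ≤ u := by
    calc (4 : ℝ) = ((4 : ℝ) ^ (6 : ℕ)) ^ ((6 : ℕ) : ℝ)⁻¹ := by
          rw [Real.pow_rpow_inv_natCast (by norm_num) (by norm_num)]
      _ = (4096 : ℝ) ^ (1 / 6 : ℝ) := by norm_num
      _ ≤ u := Real.rpow_le_rpow (by norm_num) hM (by norm_num)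
  have hupos : 0 < u := by linarith
  have hu6 : u ^ (6 : ℕ) = M := by
    rw [hu, ← Real.rpow_natCast, ← Real.rpow_mul hMpos.le]; norm_num
  have hτ : hbTau (1 / 6) X = u⁻¹ := by
    rw [hbTau, ← hLdef, ← hMdef, hu, show (-(1 / 6) : ℝ) = -(1 / 6 : ℝ) by norm_num,
      Real.rpow_neg hMpos.le]
  set τ := hbTau (1 / 6) X with hτdef
  have hτpos : 0 < τ := by rw [hτ]; positivity
  have hτu : τ * u = 1 := by rw [hτ, inv_mul_cancel₀ hupos.ne']
  -- `B ≤ 2u⁵`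
  have hτ1 : τ ≤ 1 := by
    rw [hτ]; exact inv_le_one_of_one_le₀ (by linarith)
  have hB : (mBound τ : ℝ) ≤ 2 * u ^ 5 := by
    have hξ : hbXi τ = (u ^ 5)⁻¹ := by rw [hbXi, hτ, inv_pow]
    rw [mBound, Nat.cast_add, Nat.cast_one, hξ, div_inv_eq_mul]
    have hu5pos : 0 < u ^ 5 := pow_pos hupos 5
    have hnn : 0 ≤ (3 / 2 - τ) * u ^ 5 := mul_nonneg (by linarith) hu5pos.le
    have h1 : (⌊(3 / 2 - τ) * u ^ 5⌋₊ : ℝ) ≤ (3 / 2 - τ) * u ^ 5 := Nat.floor_le hnn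
    have hu5 : (2 : ℝ) ≤ u ^ 5 := by nlinarith [pow_le_pow_left₀ (by norm_num : (0:ℝ) ≤ 4) hu4 5]
    nlinarith [mul_nonneg hτpos.le hu5pos.le]
  -- `n₂ + 1 ≤ 2u`, `n₂ + 3 ≤ 3u`
  have hn₂ : (u2Bound τ : ℝ) ≤ 3 / 2 * u := by
    have := Nat.floor_le (show (0 : ℝ) ≤ 3 / (2 * τ) by positivity)
    rw [u2Bound]
    calc (⌊3 / (2 * τ)⌋₊ : ℝ) ≤ 3 / (2 * τ) := this
      _ = 3 / 2 * u := by rw [hτ]; field_simp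
  have hn₂1 : ((u2Bound τ + 1 : ℕ) : ℝ) ≤ 2 * u := by push_cast; linarith
  have hn₂3 : ((u2Bound τ + 3 : ℕ) : ℝ) ≤ 3 * u := by push_cast; linarith
  -- assemble: `N₂ ≤ 2u (2u⁵)^{3u}`
  have hbase : (1 : ℝ) ≤ 2 * u ^ 5 := by nlinarith [pow_le_pow_left₀ (by norm_num : (0:ℝ) ≤ 4) hu4 5]
  have hpow : ((mBound τ ^ (u2Bound τ + 3) : ℕ) : ℝ) ≤ (2 * u ^ 5) ^ (3 * u) := by
    calc ((mBound τ ^ (u2Bound τ + 3) : ℕ) : ℝ) = (mBound τ : ℝ) ^ ((u2Bound τ + 3 : ℕ) : ℝ) := by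
          rw [Real.rpow_natCast]; push_cast; ring
      _ ≤ (2 * u ^ 5) ^ ((u2Bound τ + 3 : ℕ) : ℝ) :=
          Real.rpow_le_rpow (Nat.cast_nonneg _) hB (Nat.cast_nonneg _)
      _ ≤ (2 * u ^ 5) ^ (3 * u) := Real.rpow_le_rpow_of_exponent_le hbase hn₂3
  have hN : (indexCount τ : ℝ) ≤ 2 * u * (2 * u ^ 5) ^ (3 * u) := by
    rw [indexCount, Nat.cast_mul]
    exact mul_le_mul hn₂1 hpow (Nat.cast_nonneg _) (by linarith)
  -- `2u (2u⁵)^{3u} = exp(log(2u) + 3u log(2u⁵)) ≤ exp(u⁶) = L`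
  have hexp : 2 * u * (2 * u ^ 5) ^ (3 * u) =
      Real.exp (Real.log (2 * u) + Real.log (2 * u ^ 5) * (3 * u)) := by
    rw [Real.exp_add, Real.exp_log (by positivity), Real.rpow_def_of_pos (by positivity)]
  have hlog2u : Real.log (2 * u) ≤ 2 * u := by
    have := Real.log_le_sub_one_of_pos (show (0:ℝ) < 2 * u by positivity); linarith
  have hlogu : Real.log u ≤ u - 1 := Real.log_le_sub_one_of_pos hupos
  have hlog2 : Real.log 2 ≤ 1 := by
    have := Real.log_two_lt_d9; linarith
  have hlog2u5 : Real.log (2 * u ^ 5) ≤ 5 * u := by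
    rw [Real.log_mul (by norm_num) (by positivity), Real.log_pow]; push_cast; nlinarith
  have hexple : Real.log (2 * u) + Real.log (2 * u ^ 5) * (3 * u) ≤ M := by
    have h1 : Real.log (2 * u ^ 5) * (3 * u) ≤ 5 * u * (3 * u) :=
      mul_le_mul_of_nonneg_right hlog2u5 (by positivity)
    have h2 : 2 * u + 15 * u ^ 2 ≤ u ^ 6 := by
      have hu2 : (16 : ℝ) ≤ u ^ 2 := by nlinarith
      have hu4' : (16 : ℝ) * u ^ 2 ≤ u ^ 6 := by nlinarith [pow_le_pow_left₀ (by norm_num : (0:ℝ) ≤ 4) hu4 4]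
      nlinarith
    rw [← hu6]; linarith
  calc (indexCount τ : ℝ) ≤ 2 * u * (2 * u ^ 5) ^ (3 * u) := hN
    _ = Real.exp (Real.log (2 * u) + Real.log (2 * u ^ 5) * (3 * u)) := hexp
    _ ≤ Real.exp M := Real.exp_le_exp.mpr hexple
    _ = L := by rw [hMdef, Real.exp_log hL]

/-! ### One piece: `|Û^{(𝐦,·)}(𝒜) − κÛ^{(𝐦,·)}(ℬ)|` from Lemmas 3.9 and 3.10 -/

/-- `|∑ a − κ∑ b| ≤ ∑ B` from termwise bounds `|a − κb| ≤ B`. [folklore] -/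
theorem abs_sum_sub_mul_sum_le {α : Type*} (s : Finset α) (a b B : α → ℝ) (κ : ℝ)
    (h : ∀ x ∈ s, |a x - κ * b x| ≤ B x) :
    |∑ x ∈ s, a x - κ * ∑ x ∈ s, b x| ≤ ∑ x ∈ s, B x := by
  rw [mul_sum, ← sum_sub_distrib]
  exact (abs_sum_le_sum_abs _ _).trans (sum_le_sum h)

/-- **One piece of the Type II bound** (pp. 19–20): for a vector `𝐦` satisfying (3.5)–(3.7) and a
coefficient `c_R`, `Û(𝒜) − κÛ(ℬ) = [Û_e(𝒜) − κÛ(ℬ)] + Û_f(𝒜)` ((3.11)) and `Û_f(𝒜)` is the sum of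
its `J + 1 ≤ log X` dyadic pieces (the support of `f` lies in `X^{1+τ} ≤ N(S) < X^{3/2−τ}`, (3.8)); so
bounds `B₉` for the leading part (Lemma 3.9) and `B₁₀` for each dyadic piece (Lemma 3.10) give
`|Û(𝒜) − κÛ(ℬ)| ≤ B₉ + (J + 1)B₁₀`. [cite: HeathBrownActa2001, §3 pp. 19–20] -/
theorem piece_bound {X η τ κ B₉ B₁₀ : ℝ} (hX : 1 < X) (hτ : 0 < τ) (hτ4 : τ ≤ 1 / 4)
    {k : ℕ} {m : Fin k → ℕ} (hm : CoreAdmissible τ m) (c : Ideal (𝓞 K) → ℝ)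
    (h9 : |bilin (boxPairs X η) pairIdeal c (eWeight X τ m) -
        κ * bilin (normWindow X η) (fun J => J) c (dWeight X τ m)| ≤ B₉)
    (h10 : ∀ j ≤ dyadicTop X τ, |bilin (boxPairs X η) pairIdeal c
        (fun S => if 2 ^ j * (X ^ (1 + τ) / 2) < (Ideal.absNorm S : ℝ) ∧
            (Ideal.absNorm S : ℝ) ≤ 2 * (2 ^ j * (X ^ (1 + τ) / 2)) then fWeight X τ m S else 0)| ≤
          B₁₀) :
    |bilin (boxPairs X η) pairIdeal c (dWeight X τ m) -
        κ * bilin (normWindow X η) (fun J => J) c (dWeight X τ m)| ≤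
      B₉ + ((dyadicTop X τ : ℕ) + 1) * B₁₀ := by
  have hX0 : 0 < X := by linarith
  have hk := length_pos_of_coreAdmissible hτ hm
  obtain ⟨hlev, htop⟩ := dyadic_levels hX hτ4
  obtain ⟨hlo, hhi⟩ := rpow_bounds_of_coreAdmissible hX.le hτ hm
  have hV₀ : 0 < X ^ (1 + τ) / 2 := by positivity
  -- support of `f`
  have hsupp : ∀ S, fWeight X τ m S ≠ 0 →
      X ^ (1 + τ) / 2 < (Ideal.absNorm S : ℝ) ∧
        (Ideal.absNorm S : ℝ) ≤ 2 ^ (dyadicTop X τ + 1) * (X ^ (1 + τ) / 2) := by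
    intro S hS
    obtain ⟨h1, h2⟩ := absNorm_mem_of_fWeight_ne_zero hX0 hk hS
    have hP : 0 < X ^ (1 + τ) := Real.rpow_pos_of_pos hX0 _
    exact ⟨by linarith, by linarith⟩
  rw [bilin_dWeight_eq X τ (boxPairs X η) pairIdeal c m,
    bilin_dyadic (boxPairs X η) pairIdeal c hV₀ (dyadicTop X τ) (fWeight X τ m) hsupp]
  have hsum : |∑ j ∈ range (dyadicTop X τ + 1), bilin (boxPairs X η) pairIdeal c
      (fun S => if 2 ^ j * (X ^ (1 + τ) / 2) < (Ideal.absNorm S : ℝ) ∧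
          (Ideal.absNorm S : ℝ) ≤ 2 * (2 ^ j * (X ^ (1 + τ) / 2)) then fWeight X τ m S else 0)| ≤
      ((dyadicTop X τ : ℕ) + 1) * B₁₀ := by
    refine (abs_sum_le_sum_abs _ _).trans ?_
    calc _ ≤ ∑ _j ∈ range (dyadicTop X τ + 1), B₁₀ :=
          sum_le_sum fun j hj => h10 j (Nat.lt_succ_iff.mp (mem_range.mp hj))
      _ = ((dyadicTop X τ : ℕ) + 1) * B₁₀ := by rw [sum_const, card_range, nsmul_eq_mul]; push_cast; ring
  calc _ = |(bilin (boxPairs X η) pairIdeal c (eWeight X τ m) -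
              κ * bilin (normWindow X η) (fun J => J) c (dWeight X τ m)) +
            ∑ j ∈ range (dyadicTop X τ + 1), bilin (boxPairs X η) pairIdeal c
              (fun S => if 2 ^ j * (X ^ (1 + τ) / 2) < (Ideal.absNorm S : ℝ) ∧
                (Ideal.absNorm S : ℝ) ≤ 2 * (2 ^ j * (X ^ (1 + τ) / 2)) then fWeight X τ m S else 0)| := by
          ring_nf
    _ ≤ _ := (abs_add_le _ _).trans (add_le_add h9 hsum)

/-! ### The parameters for large `X` -/

/-- Eventually (in `X`), with `L = log X`, `η = L^{−c}`, `τ = (log L)^{−1/6}`, `Q₁ = L^A`: `X ≥ 2`,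
`L ≥ 8`, `log L ≥ 4096`, `0 < η ≤ 1`, `η` is in the range (2.1), `0 < τ ≤ 1/4`, `L^{-1} ≤ τ`,
`1 ≤ Q₁ ≤ exp(L^{1/3})`. [folklore] -/
theorem eventually_typeII_params {c A : ℝ} (hc : 0 < c) (hA : 0 < A) :
    ∀ᶠ X : ℝ in atTop,
      2 ≤ X ∧ 8 ≤ Real.log X ∧ 4096 ≤ Real.log (Real.log X) ∧
        0 < Real.log X ^ (-c) ∧ Real.log X ^ (-c) ≤ 1 ∧
        Real.exp (-Real.log X ^ (1 / 3 : ℝ)) ≤ Real.log X ^ (-c) ∧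
        0 < hbTau (1 / 6) X ∧ hbTau (1 / 6) X ≤ 1 / 4 ∧ (Real.log X)⁻¹ ≤ hbTau (1 / 6) X ∧
        1 ≤ Real.log X ^ A ∧ Real.log X ^ A ≤ Real.exp (Real.log X ^ (1 / 3 : ℝ)) := by
  have hlog : ∀ᶠ L : ℝ in atTop, ‖Real.log L‖ ≤ (1 / A) * ‖L ^ (1 / 3 : ℝ)‖ :=
    (isLittleO_log_rpow_atTop (by norm_num : (0 : ℝ) < 1 / 3)).def (by positivity)
  have hM : ∀ᶠ X : ℝ in atTop, (4096 : ℝ) ≤ Real.log (Real.log X) :=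
    (Real.tendsto_log_atTop.comp Real.tendsto_log_atTop).eventually (eventually_ge_atTop _)
  filter_upwards [eventually_params hc 0, Real.tendsto_log_atTop.eventually (eventually_ge_atTop (8 : ℝ)),
    hM, Real.tendsto_log_atTop.eventually hlog] with X hP hL8 hMX hlogX
  obtain ⟨hX2, hη0, hη10, h21, hτ0, hτ4, -⟩ := hP
  set L := Real.log X with hL
  set M := Real.log L with hMdef
  have hLpos : 0 < L := by linarith
  have hL1 : 1 ≤ L := by linarith
  have hMpos : 0 < M := by linarith
  refine ⟨hX2, hL8, hMX, hη0, by linarith, h21, hτ0, hτ4, ?_, Real.one_le_rpow hL1 hA.le, ?_⟩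
  · -- `1/L ≤ τ = M^{-1/6}`: `M^{1/6} ≤ M ≤ L`
    have hτ : hbTau (1 / 6) X = (M ^ (1 / 6 : ℝ))⁻¹ := by
      rw [hbTau, ← hL, ← hMdef, show (-(1 / 6) : ℝ) = -(1 / 6 : ℝ) by norm_num,
        Real.rpow_neg hMpos.le]
    rw [hτ]
    have hM1 : 1 ≤ M := by linarith
    have hML : M ≤ L := by
      have := Real.log_le_sub_one_of_pos hLpos; rw [← hMdef] at this; linarith
    have h16 : M ^ (1 / 6 : ℝ) ≤ L :=
      calc M ^ (1 / 6 : ℝ) ≤ M ^ (1 : ℝ) := Real.rpow_le_rpow_of_exponent_le hM1 (by norm_num)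
        _ = M := Real.rpow_one M
        _ ≤ L := hML
    exact inv_anti₀ (Real.rpow_pos_of_pos hMpos _) h16
  · -- `L^A = exp(A log L) ≤ exp(L^{1/3})`
    have h13 : 0 < L ^ (1 / 3 : ℝ) := Real.rpow_pos_of_pos hLpos _
    have hlogL : 0 ≤ Real.log L := Real.log_nonneg hL1
    rw [Real.norm_eq_abs, Real.norm_eq_abs, abs_of_nonneg hlogL, abs_of_pos h13] at hlogX
    have h1 : A * Real.log L ≤ L ^ (1 / 3 : ℝ) := by
      calc A * Real.log L ≤ A * ((1 / A) * L ^ (1 / 3 : ℝ)) := by gcongr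
        _ = L ^ (1 / 3 : ℝ) := by field_simp
    calc L ^ A = Real.exp (Real.log L * A) := Real.rpow_def_of_pos hLpos A
      _ ≤ Real.exp (L ^ (1 / 3 : ℝ)) := Real.exp_le_exp.mpr (by linarith)

/-! ### The Type II block ((3.15), p. 21) from Lemmas 3.7, 3.8, 3.9 and 3.10 -/

/-- `|G(𝒜) − κG(ℬ)| ≤ |G(𝒜) − Ĝ(𝒜)| + κ|G(ℬ) − Ĝ(ℬ)| + |Ĝ(𝒜) − κĜ(ℬ)|` (`κ ≥ 0`). [folklore] -/
theorem abs_sub_mul_le_three (GA GB HA HB κ : ℝ) (hκ : 0 ≤ κ) :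
    |GA - κ * GB| ≤ |GA - HA| + κ * |GB - HB| + |HA - κ * HB| := by
  have h : GA - κ * GB = (GA - HA) + (HA - κ * HB) - κ * (GB - HB) := by ring
  rw [h]
  calc |(GA - HA) + (HA - κ * HB) - κ * (GB - HB)|
      ≤ |(GA - HA) + (HA - κ * HB)| + |κ * (GB - HB)| := abs_sub _ _
    _ ≤ |GA - HA| + |HA - κ * HB| + |κ * (GB - HB)| := by gcongr; exact abs_add_le _ _
    _ = |GA - HA| + κ * |GB - HB| + |HA - κ * HB| := by rw [abs_mul, abs_of_nonneg hκ]; ring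

/-- **The Type II block `HeathBrown2001_typeII_terms` from Lemmas 3.7–3.10** — the argument of
pp. 19–21: fix `ϖ = 1/6`; Lemma 3.9 and Lemma 3.10 (fed by Lemma 3.8 with `Q₁ = (log X)^A`) bound
each piece `Û^{(𝐦,·)}(𝒜) − κÛ^{(𝐦,·)}(ℬ)` by `B₉ + (J+1)B₁₀` (`piece_bound`), the number of pieces is
`≤ log X` (`indexCount_le_log`, p. 20) as is the number `J + 1` of dyadic ranges, Lemma 3.7 bounds the
approximation errors by `ξτ^{−4}η²X²/log X = τη²X²/log X` (and `κ · ξτ^{−4}ηX³/log X = (σ₀/3)τη²X²/log X`),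
and with `η = (log X)^{−c}`, `c = 2c_* + 6`, `A = 160(2c + c_* + 4)` (`c_* = max(c₉, c₁₀, 0)`) the terms
`(log X) B₉` and `(log X)² B₁₀` are `≤ |C₉| τη²X²/log X`, `≤ |C₁₀| τη²X²/log X` because
`(log X)^{-1} ≤ τ` ((3.15) and "we then take `η = (log X)^{−2c₀}` and `Q₁ = (log X)^{600c₀}`. These
choices are consistent with (2.1) and Lemma 3.8", p. 21; the exponents here are chosen generously).
[cite: HeathBrownActa2001, §3 (3.15) and p. 21] -/
theorem HeathBrown2001_typeII_terms_of (h37 : HeathBrown2001_lemma_3_7)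
    (h38 : HeathBrown2001_lemma_3_8) (h39 : HeathBrown2001_lemma_3_9)
    (h310 : HeathBrown2001_lemma_3_10) : HeathBrown2001_typeII_terms := by
  intro σ₀ hσ
  have hσ0 : 0 ≤ σ₀ := ge_of_tendsto' hσ fun N => (singularProductPartial_pos N).le
  obtain ⟨C₇, X₇, H7⟩ := h37 (1 / 6) (by norm_num) (by norm_num)
  obtain ⟨c₉, C₉, X₉, H9⟩ := h39 σ₀ hσ (1 / 6) (by norm_num) (by norm_num)
  obtain ⟨c₁₀, c₃, c₄, hc₃, hc₄, H10⟩ := h310 (1 / 6) (by norm_num) (by norm_num)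
  set cs := max (max c₉ c₁₀) 0 with hcs
  have hcs0 : 0 ≤ cs := le_max_right _ _
  have hc₉cs : c₉ ≤ cs := (le_max_left _ _).trans (le_max_left _ _)
  have hc₁₀cs : c₁₀ ≤ cs := (le_max_right _ _).trans (le_max_left _ _)
  set cη := 2 * cs + 6 with hcη
  have hcη0 : 0 < cη := by rw [hcη]; linarith
  set A := 160 * (2 * cη + cs + 4) with hAdef
  have hA0 : 0 < A := by rw [hAdef]; linarith
  obtain ⟨C₁, c₁, X₈, hc₁, H8⟩ := h38 (1 / 6) (by norm_num) (by norm_num) A c₃ c₄ hA0 hc₃ hc₄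
  obtain ⟨C₁₀, X₁₀, H10'⟩ := H10 C₁ c₁ (1 / 2) 1 hc₁ (by norm_num) (by norm_num)
  obtain ⟨X₀, hX₀⟩ := eventually_atTop.mp ((eventually_typeII_params hcη0 hA0).and
    ((eventually_ge_atTop X₇).and ((eventually_ge_atTop X₈).and
      ((eventually_ge_atTop X₉).and (eventually_ge_atTop X₁₀)))))
  refine ⟨cη, hcη0, 5 * |C₇| * (1 + σ₀ / 3) + 5 * (|C₉| + |C₁₀|), X₀, fun X hX => ?_⟩
  obtain ⟨⟨hX2, hL8, hM, hη0, hη1, h21, hτ0, hτ4, hτL, hQ1, hQexp⟩, hX7, hX8, hX9, hX10⟩ :=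
    hX₀ X hX
  -- abbreviations
  set L := Real.log X with hL
  set η := L ^ (-cη) with hηdef
  set τ := hbTau (1 / 6) X with hτdef
  set κ := kappa σ₀ X η with hκ
  set Q₁ := L ^ A with hQ₁
  have hX1 : 1 < X := by linarith
  have hX0 : 0 < X := by linarith
  have hLpos : 0 < L := by linarith
  have hL1 : 1 ≤ L := by linarith
  have hκ0 : 0 ≤ κ := by rw [hκ, kappa]; positivity
  have hτ1 : τ ≤ 1 := by linarith
  -- the facts at this `X`
  obtain ⟨h7U, h7U1, h7U2, h7S4, h7V, h7UB, h7U1B, h7U2B, h7S4B, h7VB⟩ := H7 X η hX7 h21 hη1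
  have h9 := H9 X η hX9 h21 hη1
  have h8 := H8 X hX8
  have h10 := H10' X η Q₁ hX10 h21 hη1 hQ1 hQexp h8
  -- piece constants
  set B₉ := |C₉| * η ^ (5 / 2 : ℝ) * X ^ 2 * L ^ cs with hB₉
  set B₁₀ := |C₁₀| * X ^ 2 * Q₁ ^ (-(1 / 160 : ℝ)) * L ^ cs with hB₁₀
  set Bp := B₉ + ((dyadicTop X τ : ℕ) + 1) * B₁₀ with hBp
  have hQ₁pos : 0 < Q₁ := by positivity
  have hB₉0 : 0 ≤ B₉ := by positivity
  have hB₁₀0 : 0 ≤ B₁₀ := by positivity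
  have hBp0 : 0 ≤ Bp := by positivity
  -- the piece bound for every admissible `𝐦` and supported `c`
  have piece : ∀ (k : ℕ) (m : Fin k → ℕ), CoreAdmissible τ m → ∀ c : Ideal (𝓞 K) → ℝ,
      CSupport X τ c →
        |bilin (boxPairs X η) pairIdeal c (dWeight X τ m) -
            κ * bilin (normWindow X η) (fun J => J) c (dWeight X τ m)| ≤ Bp := by
    intro k m hm c hc
    refine piece_bound hX1 hτ0 hτ4 hm c ?_ ?_
    · -- Lemma 3.9
      refine (h9 k m hm c hc).trans ?_
      have hM1 := one_le_prod_of_coreAdmissible hτ0 hτ1 hm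
      have hMinv : (∏ i, (m i : ℝ))⁻¹ ≤ 1 := inv_le_one_of_one_le₀ hM1
      have hLc : L ^ c₉ ≤ L ^ cs := Real.rpow_le_rpow_of_exponent_le hL1 hc₉cs
      have hrest : 0 ≤ (∏ i, (m i : ℝ))⁻¹ * η ^ (5 / 2 : ℝ) * X ^ 2 * L ^ c₉ := by positivity
      calc C₉ * (∏ i, (m i : ℝ))⁻¹ * η ^ (5 / 2 : ℝ) * X ^ 2 * L ^ c₉
          = C₉ * ((∏ i, (m i : ℝ))⁻¹ * η ^ (5 / 2 : ℝ) * X ^ 2 * L ^ c₉) := by ring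
        _ ≤ |C₉| * ((∏ i, (m i : ℝ))⁻¹ * η ^ (5 / 2 : ℝ) * X ^ 2 * L ^ c₉) :=
            mul_le_mul_of_nonneg_right (le_abs_self _) hrest
        _ ≤ |C₉| * (1 * η ^ (5 / 2 : ℝ) * X ^ 2 * L ^ cs) := by gcongr
        _ = B₉ := by rw [hB₉]; ring
    · -- Lemma 3.10 on each dyadic range, (3.14) from Lemma 3.8
      intro j hj
      obtain ⟨hVlo, hVhi⟩ := (dyadic_levels hX1 hτ4).1 j hj
      refine (h10 k m hm c hc _ hVlo hVhi).trans ?_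
      have hLc : L ^ c₁₀ ≤ L ^ cs := Real.rpow_le_rpow_of_exponent_le hL1 hc₁₀cs
      have hrest : 0 ≤ X ^ 2 * Q₁ ^ (-(1 / 160 : ℝ)) * L ^ c₁₀ := by positivity
      calc C₁₀ * X ^ 2 * Q₁ ^ (-(1 / 160 : ℝ)) * L ^ c₁₀
          = C₁₀ * (X ^ 2 * Q₁ ^ (-(1 / 160 : ℝ)) * L ^ c₁₀) := by ring
        _ ≤ |C₁₀| * (X ^ 2 * Q₁ ^ (-(1 / 160 : ℝ)) * L ^ c₁₀) :=
            mul_le_mul_of_nonneg_right (le_abs_self _) hrest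
        _ ≤ |C₁₀| * (X ^ 2 * Q₁ ^ (-(1 / 160 : ℝ)) * L ^ cs) := by gcongr
        _ = B₁₀ := by rw [hB₁₀]; ring
  -- the approximations compared piecewise: `|Ĝ(𝒜) − κĜ(ℬ)| ≤ #pieces · Bp`
  have gU : ∀ n, |Uhat X τ (boxPairs X η) pairIdeal n - κ * Uhat X τ (normWindow X η) (fun J => J) n| ≤
      #(mIndexU τ n) * Bp := by
    intro n
    unfold Uhat
    refine (abs_sum_sub_mul_sum_le _ _ _ (fun _ => Bp) κ fun m hm => ?_).trans
      (by rw [sum_const, nsmul_eq_mul])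
    have hmU := (mem_mIndexU_iff hτ0).mp hm
    exact piece (n + 1) m hmU.1 _ (cSupport_cCoef (rpow_tau_le_rpow_last hX1.le hτ0 hmU.1))
  have gS4 : |S4hat X τ (boxPairs X η) pairIdeal - κ * S4hat X τ (normWindow X η) (fun J => J)| ≤
      #(mIndexCore τ 1) * Bp := by
    unfold S4hat
    refine (abs_sum_sub_mul_sum_le _ _ _ (fun _ => Bp) κ fun m hm => ?_).trans
      (by rw [sum_const, nsmul_eq_mul])
    have hmc := (mem_mIndexCore_iff hτ0).mp hm
    exact piece 1 m hmc _ (cSupport_cCoef (rpow_tau_le_rpow_last (n := 0) hX1.le hτ0 hmc))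
  have gV : |U2hat X τ (boxPairs X η) pairIdeal - κ * U2hat X τ (normWindow X η) (fun J => J)| ≤
      (∑ nn ∈ nPairs τ, ∑ n ∈ range (u2Bound τ + 1), (#(mIndexU2 τ n nn.2) : ℝ)) * Bp := by
    unfold U2hat
    rw [sum_mul]
    refine abs_sum_sub_mul_sum_le _ _ _ _ κ fun nn hnn => ?_
    rw [sum_mul]
    refine abs_sum_sub_mul_sum_le _ _ _ _ κ fun n _ => ?_
    refine (abs_sum_sub_mul_sum_le _ _ _ (fun _ => Bp) κ fun m hm => ?_).trans
      (by rw [sum_const, nsmul_eq_mul])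
    obtain ⟨hmc, -⟩ := (mem_mIndexU2_iff hτ0).mp hm
    obtain ⟨h₂, h₁₂, -, -⟩ := mem_nPairs hnn
    exact piece _ m hmc _ (cSupport_c2Coef hX1.le hτ0 h₂ h₁₂.le)
  -- counts
  have hN : (indexCount τ : ℝ) ≤ L := indexCount_le_log hLpos hM
  have hJ : ((dyadicTop X τ : ℕ) : ℝ) + 1 ≤ L := dyadicTop_add_one_le hL8 hτ0.le hτ4
  have hNBp : (indexCount τ : ℝ) * Bp ≤ L * B₉ + L * L * B₁₀ := by
    calc (indexCount τ : ℝ) * Bp ≤ L * Bp := mul_le_mul_of_nonneg_right hN hBp0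
      _ = L * B₉ + L * (((dyadicTop X τ : ℕ) : ℝ) + 1) * B₁₀ := by rw [hBp]; ring
      _ ≤ L * B₉ + L * L * B₁₀ := by gcongr
  have gU' : ∀ n ≤ 2, |Uhat X τ (boxPairs X η) pairIdeal n -
      κ * Uhat X τ (normWindow X η) (fun J => J) n| ≤ L * B₉ + L * L * B₁₀ := fun n hn =>
    (gU n).trans ((mul_le_mul_of_nonneg_right (card_mIndexU_le_indexCount τ hn) hBp0).trans hNBp)
  have gS4' : |S4hat X τ (boxPairs X η) pairIdeal - κ * S4hat X τ (normWindow X η) (fun J => J)| ≤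
      L * B₉ + L * L * B₁₀ :=
    gS4.trans ((mul_le_mul_of_nonneg_right (card_mIndexCore_one_le_indexCount τ) hBp0).trans hNBp)
  have gV' : |U2hat X τ (boxPairs X η) pairIdeal - κ * U2hat X τ (normWindow X η) (fun J => J)| ≤
      L * B₉ + L * L * B₁₀ :=
    gV.trans ((mul_le_mul_of_nonneg_right (sum_card_mIndexU2_le τ) hBp0).trans hNBp)
  have gUsum : ∑ n ∈ Icc 3 (chainBound τ), |Uhat X τ (boxPairs X η) pairIdeal n -
      κ * Uhat X τ (normWindow X η) (fun J => J) n| ≤ L * B₉ + L * L * B₁₀ := by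
    calc _ ≤ ∑ n ∈ Icc 3 (chainBound τ), (#(mIndexU τ n) : ℝ) * Bp := sum_le_sum fun n _ => gU n
      _ = (∑ n ∈ Icc 3 (chainBound τ), (#(mIndexU τ n) : ℝ)) * Bp := by rw [sum_mul]
      _ ≤ (indexCount τ : ℝ) * Bp := mul_le_mul_of_nonneg_right (sum_card_mIndexU_le hτ0) hBp0
      _ ≤ _ := hNBp
  -- exponents: everything as powers of `L`
  set W := τ * X ^ 2 * L ^ (-2 * cη - 1) with hW
  have hW0 : 0 ≤ W := by positivity
  have hη2 : η ^ 2 = L ^ (-2 * cη) := by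
    rw [hηdef, ← Real.rpow_natCast, ← Real.rpow_mul hLpos.le]; ring_nf
  have hF1 : η ^ 2 * X ^ 2 / L = X ^ 2 * L ^ (-2 * cη - 1) := by
    rw [hη2, Real.rpow_sub hLpos, Real.rpow_one]; ring
  have hEA : C₇ * (hbXi τ / τ ^ 4) * (η ^ 2 * X ^ 2 / L) ≤ |C₇| * W := by
    have hξτ : hbXi τ / τ ^ 4 = τ := by
      rw [hbXi, div_eq_iff (pow_ne_zero 4 hτ0.ne')]; ring
    rw [hξτ, hF1, hW, show C₇ * τ * (X ^ 2 * L ^ (-2 * cη - 1)) = C₇ * (τ * X ^ 2 * L ^ (-2 * cη - 1)) by ring]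
    exact mul_le_mul_of_nonneg_right (le_abs_self _) hW0
  have hEB : κ * (C₇ * (hbXi τ / τ ^ 4) * (η * X ^ 3 / L)) ≤ |C₇| * (σ₀ / 3) * W := by
    have hξτ : hbXi τ / τ ^ 4 = τ := by
      rw [hbXi, div_eq_iff (pow_ne_zero 4 hτ0.ne')]; ring
    have hκη : κ * (η * X ^ 3 / L) = σ₀ / 3 * (η ^ 2 * X ^ 2 / L) := by
      rw [hκ, kappa]; field_simp
    calc κ * (C₇ * (hbXi τ / τ ^ 4) * (η * X ^ 3 / L)) = C₇ * τ * (κ * (η * X ^ 3 / L)) := by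
          rw [hξτ]; ring
      _ = C₇ * (σ₀ / 3 * W) := by rw [hκη, hF1, hW]; ring
      _ ≤ |C₇| * (σ₀ / 3 * W) := mul_le_mul_of_nonneg_right (le_abs_self _) (by positivity)
      _ = |C₇| * (σ₀ / 3) * W := by ring
  have hLB₉ : L * B₉ ≤ |C₉| * W := by
    -- `L · η^{5/2} L^{cs} = L^{1 − 5cη/2 + cs} = L^{−2cη−1} · L^{−1} ≤ L^{−2cη−1} τ`
    have hη52 : η ^ (5 / 2 : ℝ) = L ^ (-cη * (5 / 2)) := by
      rw [hηdef, ← Real.rpow_mul hLpos.le]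
    have hexp : L * η ^ (5 / 2 : ℝ) * L ^ cs = L ^ (-2 * cη - 1) * L⁻¹ := by
      rw [hη52, ← Real.rpow_neg_one, ← Real.rpow_add hLpos, show L * L ^ (-cη * (5 / 2)) * L ^ cs =
        L ^ (1 : ℝ) * L ^ (-cη * (5 / 2)) * L ^ cs by rw [Real.rpow_one], ← Real.rpow_add hLpos,
        ← Real.rpow_add hLpos]
      congr 1; rw [hcη]; ring
    calc L * B₉ = |C₉| * X ^ 2 * (L * η ^ (5 / 2 : ℝ) * L ^ cs) := by rw [hB₉]; ring
      _ = |C₉| * X ^ 2 * (L ^ (-2 * cη - 1) * L⁻¹) := by rw [hexp]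
      _ ≤ |C₉| * X ^ 2 * (L ^ (-2 * cη - 1) * τ) := by gcongr
      _ = |C₉| * W := by rw [hW]; ring
  have hLB₁₀ : L * L * B₁₀ ≤ |C₁₀| * W := by
    have hQpow : Q₁ ^ (-(1 / 160 : ℝ)) = L ^ (A * (-(1 / 160))) := by
      rw [hQ₁, ← Real.rpow_mul hLpos.le]
    have hexp : L * L * Q₁ ^ (-(1 / 160 : ℝ)) * L ^ cs = L ^ (-2 * cη - 1) * L⁻¹ := by
      rw [hQpow, ← Real.rpow_neg_one, ← Real.rpow_add hLpos,
        show L * L * L ^ (A * (-(1 / 160))) * L ^ cs =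
          L ^ (1 : ℝ) * L ^ (1 : ℝ) * L ^ (A * (-(1 / 160))) * L ^ cs by rw [Real.rpow_one],
        ← Real.rpow_add hLpos, ← Real.rpow_add hLpos, ← Real.rpow_add hLpos]
      congr 1; rw [hAdef, hcη]; ring
    calc L * L * B₁₀ = |C₁₀| * X ^ 2 * (L * L * Q₁ ^ (-(1 / 160 : ℝ)) * L ^ cs) := by rw [hB₁₀]; ring
      _ = |C₁₀| * X ^ 2 * (L ^ (-2 * cη - 1) * L⁻¹) := by rw [hexp]
      _ ≤ |C₁₀| * X ^ 2 * (L ^ (-2 * cη - 1) * τ) := by gcongr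
      _ = |C₁₀| * W := by rw [hW]; ring
  -- the five groups
  have hII : L * B₉ + L * L * B₁₀ ≤ (|C₉| + |C₁₀|) * W := by linarith
  have tU1 := abs_sub_mul_le_three (U1piece (boxPairs X η) pairIdeal X τ 1 : ℝ)
    (U1piece (normWindow X η) (fun J => J) X τ 1 : ℝ) (Uhat X τ (boxPairs X η) pairIdeal 1)
    (Uhat X τ (normWindow X η) (fun J => J) 1) κ hκ0
  have tU2 := abs_sub_mul_le_three (U1piece (boxPairs X η) pairIdeal X τ 2 : ℝ)
    (U1piece (normWindow X η) (fun J => J) X τ 2 : ℝ) (Uhat X τ (boxPairs X η) pairIdeal 2)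
    (Uhat X τ (normWindow X η) (fun J => J) 2) κ hκ0
  have tS4 := abs_sub_mul_le_three (S₄ (boxPairs X η) pairIdeal X τ : ℝ)
    (S₄ (normWindow X η) (fun J => J) X τ : ℝ) (S4hat X τ (boxPairs X η) pairIdeal)
    (S4hat X τ (normWindow X η) (fun J => J)) κ hκ0
  have tV := abs_sub_mul_le_three (U2one (boxPairs X η) pairIdeal X τ : ℝ)
    (U2one (normWindow X η) (fun J => J) X τ : ℝ) (U2hat X τ (boxPairs X η) pairIdeal)
    (U2hat X τ (normWindow X η) (fun J => J)) κ hκ0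
  have tU : ∑ n ∈ Icc 3 (chainBound τ), |(Upiece (boxPairs X η) pairIdeal X τ n : ℝ) -
      κ * Upiece (normWindow X η) (fun J => J) X τ n| ≤
      ∑ n ∈ Icc 3 (chainBound τ), |(Upiece (boxPairs X η) pairIdeal X τ n : ℝ) -
          Uhat X τ (boxPairs X η) pairIdeal n| +
        κ * ∑ n ∈ Icc 3 (chainBound τ), |(Upiece (normWindow X η) (fun J => J) X τ n : ℝ) -
          Uhat X τ (normWindow X η) (fun J => J) n| +
        ∑ n ∈ Icc 3 (chainBound τ), |Uhat X τ (boxPairs X η) pairIdeal n -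
          κ * Uhat X τ (normWindow X η) (fun J => J) n| := by
    rw [mul_sum, ← sum_add_distrib, ← sum_add_distrib]
    exact sum_le_sum fun n _ => abs_sub_mul_le_three _ _ _ _ κ hκ0
  -- L3.7 bounds in terms of `W`
  have e1 := h7U1.trans hEA
  have e2 := h7U2.trans hEA
  have e3 := h7U.trans hEA
  have e4 := h7V.trans hEA
  have e5 := h7S4.trans hEA
  have f1 : κ * |(U1piece (normWindow X η) (fun J => J) X τ 1 : ℝ) -
      Uhat X τ (normWindow X η) (fun J => J) 1| ≤ |C₇| * (σ₀ / 3) * W :=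
    (mul_le_mul_of_nonneg_left h7U1B hκ0).trans hEB
  have f2 : κ * |(U1piece (normWindow X η) (fun J => J) X τ 2 : ℝ) -
      Uhat X τ (normWindow X η) (fun J => J) 2| ≤ |C₇| * (σ₀ / 3) * W :=
    (mul_le_mul_of_nonneg_left h7U2B hκ0).trans hEB
  have f3 : κ * ∑ n ∈ Icc 3 (chainBound τ), |(Upiece (normWindow X η) (fun J => J) X τ n : ℝ) -
      Uhat X τ (normWindow X η) (fun J => J) n| ≤ |C₇| * (σ₀ / 3) * W :=
    (mul_le_mul_of_nonneg_left h7UB hκ0).trans hEB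
  have f4 : κ * |(U2one (normWindow X η) (fun J => J) X τ : ℝ) -
      U2hat X τ (normWindow X η) (fun J => J)| ≤ |C₇| * (σ₀ / 3) * W :=
    (mul_le_mul_of_nonneg_left h7VB hκ0).trans hEB
  have f5 : κ * |(S₄ (normWindow X η) (fun J => J) X τ : ℝ) -
      S4hat X τ (normWindow X η) (fun J => J)| ≤ |C₇| * (σ₀ / 3) * W :=
    (mul_le_mul_of_nonneg_left h7S4B hκ0).trans hEB
  -- conclude
  have hgoal : (5 * |C₇| * (1 + σ₀ / 3) + 5 * (|C₉| + |C₁₀|)) * τ * η ^ 2 * X ^ 2 / L =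
      (5 * |C₇| * (1 + σ₀ / 3) + 5 * (|C₉| + |C₁₀|)) * W := by
    rw [hW, show τ * X ^ 2 * L ^ (-2 * cη - 1) = τ * (X ^ 2 * L ^ (-2 * cη - 1)) by ring, ← hF1]
    ring
  rw [hgoal]
  have g1 := (gU' 1 (by norm_num)).trans hII
  have g2 := (gU' 2 (by norm_num)).trans hII
  have g3 := gUsum.trans hII
  have g4 := gV'.trans hII
  have g5 := gS4'.trans hII
  linarith [tU1, tU2, tS4, tV, tU, e1, e2, e3, e4, e5, f1, f2, f3, f4, f5, g1, g2, g3, g4, g5]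

/-- **(2.4) (`HeathBrown2001_sieveComparison`) from Lemmas 3.5, 3.6, 3.7, 3.8, 3.9, 3.10** (Lemma 3.4
and the Type II bookkeeping being proved). [cite: HeathBrownActa2001, §3 (3.15) and p. 21] -/
theorem HeathBrown2001_sieveComparison_of_lemmas (h35 : HeathBrown2001_lemma_3_5)
    (h36 : HeathBrown2001_lemma_3_6) (h37 : HeathBrown2001_lemma_3_7)
    (h38 : HeathBrown2001_lemma_3_8) (h39 : HeathBrown2001_lemma_3_9)
    (h310 : HeathBrown2001_lemma_3_10) : HeathBrown2001_sieveComparison :=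
  HeathBrown2001_sieveComparison_of h35 h36 (HeathBrown2001_typeII_terms_of h37 h38 h39 h310)

/-- **The quantitative theorem (2.2) from the prime ideal theorem and Lemmas 3.5–3.10.**
[cite: HeathBrownActa2001, Theorem (p. 2)] -/
theorem HeathBrown2001_primePairCount_asymptotic_of_lemmas
    (hPIT : Literature.NumberTheory.LFunctions.NumberField.primeIdealTheorem) (h35 : HeathBrown2001_lemma_3_5)
    (h36 : HeathBrown2001_lemma_3_6) (h37 : HeathBrown2001_lemma_3_7)
    (h38 : HeathBrown2001_lemma_3_8) (h39 : HeathBrown2001_lemma_3_9)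
    (h310 : HeathBrown2001_lemma_3_10) : HeathBrown2001_primePairCount_asymptotic :=
  HeathBrown2001_primePairCount_asymptotic_of_sieveLemmas hPIT h35 h36
    (HeathBrown2001_typeII_terms_of h37 h38 h39 h310)

/-- **parity.S18 from Landau's prime ideal theorem and Heath-Brown's Lemmas 3.5, 3.6, 3.7, 3.8, 3.9,
3.10** — the current frontier of the decomposition, every item of which is a printed lemma.
[cite: HeathBrownActa2001, Theorem (p. 2)] -/
theorem _root_.Literature.NumberTheory.Sieve.setOf_prime_cube_add_two_mul_cube_infinite_of_lemmas
    (hPIT : Literature.NumberTheory.LFunctions.NumberField.primeIdealTheorem) (h35 : HeathBrown2001_lemma_3_5)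
    (h36 : HeathBrown2001_lemma_3_6) (h37 : HeathBrown2001_lemma_3_7)
    (h38 : HeathBrown2001_lemma_3_8) (h39 : HeathBrown2001_lemma_3_9)
    (h310 : HeathBrown2001_lemma_3_10) :
    Literature.NumberTheory.Sieve.setOf_prime_cube_add_two_mul_cube_infinite :=
  Literature.NumberTheory.Sieve.setOf_prime_cube_add_two_mul_cube_infinite_of_sieveLemmas hPIT h35 h36
    (HeathBrown2001_typeII_terms_of h37 h38 h39 h310)

end Literature.NumberTheory.Sieve.CubicSieve

end
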